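import Mathlib
import Literature.NumberTheory.DiophantineGeometry.FirstRowPeeling
import Literature.NumberTheory.DiophantineGeometry.SymmetricGroupRepsSignTwist
import Literature.NumberTheory.DiophantineGeometry.SymmetricGroupRepsFinrankSpechtProofs
import Literature.NumberTheory.DiophantineGeometry.SymmetricGroupReps
import HarnessLib

/-!
# ValiantsHypothesis / SymPencil — crux `EquivariantSdcNotQP` (stmt-ValiantsHypothesis-17792), line
# `birth_EquivariantSdcNotQP`, stub `stub_permify`, the Young-tableaux degree inequality (YD): step 1 —
# TOOLS (monotonicity of `f^λ`, transposition, long first rows, the index of a Young subgroup)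

Preliminaries for the proof of (YD) «`∃ c, ∀ λ ⊢ n, ∃ ν ∈ {λ, λᵗ}, [𝔖_n : R_ν] ≤ 2^{(log₂ f^λ + log₂ n + c)^c}`»
(hypothesis `hYD` of `youngFixedVector_of_degreeBound`), on the tree's tableaux layer
(`PartitionTableaux`, `StandardFillings`, `PartitionTableauxProofs`, `FirstRowPeeling`).  Helper of the
item (`--supports stmt-ValiantsHypothesis-17792 --as helper`); 0 definitions, 0 named facts:
* `card_stdFilling_mono`, `numStandardTableaux_mono` — **monotonicity `f^μ ≤ f^λ` for `μ ⊆ λ`** (from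
  the branching rule `StdFilling.card_stdFilling_succ`: removing a maximal cell outside `μ` is a corner
  removal, whose term appears in the branching sum);
* `numStandardTableaux_transpose` — `f^{λᵗ} = f^λ` (through `dim S^λ = f^λ` and `S^{λᵗ} ≅ S^λ ⊗ sgn`);
* `choose_le_three_mul_numStandardTableaux` — `C(n, j) ≤ 3 f^{(a,ν)}` for a long first row `a ≥ 2j`
  (`FirstRowPeeling.choose_mul_numStandardTableaux_le_exp_mul`, `e < 3`, `f^ν ≥ 1`);
* `two_pow_le_choose` — `2^j ≤ C(n, j)` for `n ≥ 3j`;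
* `index_rowStabilizer_mul_factorial_le` — `[𝔖_n : R_λ] · λ₁! ≤ n!` (the permutations of the first
  row lie in the Young subgroup `R_λ`).

Honest framing: tableaux combinatorics; (YD), (H1), `stub_permify`, the crux and `VP ≠ VNP` remain OPEN
here.
-/

noncomputable section

set_option linter.dupNamespace false

namespace Summit.ValiantsHypothesis.ValiantsHypothesis.Theorems.SymPencilEquivariantSdcNotQP.YoungBounds

open Literature.NumberTheory.DiophantineGeometry

/-! ### Monotonicity of `f^λ` under inclusion of diagrams -/

/-- One branching term: for a cell `c` of `Y` (`|Y| = m + 1`), `#Std_m(Y ⊖ c) ≤ #Std_{m+1}(Y)`.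
[folklore] -/
theorem card_stdFilling_removeAbove_le (Y : YoungDiagram) (m : ℕ) {c : ℕ × ℕ} (hc : c ∈ Y.cells) :
    Nat.card (StdFilling m (Y.removeAbove c)) ≤ Nat.card (StdFilling (m + 1) Y) := by
  rw [StdFilling.card_stdFilling_succ]
  exact Finset.single_le_sum (f := fun c => Nat.card (StdFilling m (Y.removeAbove c)))
    (fun _ _ => Nat.zero_le _) hc

/-- **Monotonicity of the number of standard Young tableaux**: if the diagram `Y'` is contained in
`Y`, then `#SYT(Y') ≤ #SYT(Y)` (remove from `Y` a maximal cell outside `Y'` — a corner — and use the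
branching rule). [folklore] -/
theorem card_stdFilling_mono :
    ∀ (d : ℕ) (Y' Y : YoungDiagram), Y'.cells ⊆ Y.cells → Y.cells.card = Y'.cells.card + d →
      Nat.card (StdFilling Y'.cells.card Y') ≤ Nat.card (StdFilling Y.cells.card Y) := by
  intro d
  induction d with
  | zero =>
    intro Y' Y hsub hcard
    have heq : Y'.cells = Y.cells := Finset.eq_of_subset_of_card_le hsub (by omega)
    have hYY : Y' = Y := YoungDiagram.ext heq
    subst hYY
    exact le_rfl
  | succ d ih =>
    intro Y' Y hsub hcard
    have hne : (Y.cells \ Y'.cells).Nonempty := by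
      rw [← Finset.card_pos, Finset.card_sdiff_of_subset hsub]
      omega
    obtain ⟨c, hc, hmax⟩ := Finset.exists_max_image (Y.cells \ Y'.cells)
      (fun x : ℕ × ℕ => x.1 + x.2) hne
    have hcY : c ∈ Y.cells := (Finset.mem_sdiff.1 hc).1
    have hcY' : c ∉ Y'.cells := (Finset.mem_sdiff.1 hc).2
    -- `c` is maximal in `Y` for the product order
    have hcmax : ∀ x ∈ Y.cells, c ≤ x → x = c := by
      intro x hx hcx
      have hxY' : x ∉ Y'.cells := fun hxY' => hcY' (Y'.isLowerSet hcx hxY')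
      have hle := hmax x (Finset.mem_sdiff.2 ⟨hx, hxY'⟩)
      obtain ⟨h1, h2⟩ := Prod.mk_le_mk.1 (show (c.1, c.2) ≤ (x.1, x.2) from hcx)
      exact Prod.ext (by omega) (by omega)
    set Y₁ := Y.removeAbove c with hY₁
    have hY₁cells : Y₁.cells = Y.cells.erase c := by
      ext x
      rw [hY₁, YoungDiagram.removeAbove_cells, Finset.mem_filter, Finset.mem_erase]
      constructor
      · rintro ⟨hx, hcx⟩
        exact ⟨fun h => hcx (h ▸ le_rfl), hx⟩
      · rintro ⟨hxc, hx⟩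
        exact ⟨hx, fun hcx => hxc (hcmax x hx hcx)⟩
    have hsub₁ : Y'.cells ⊆ Y₁.cells := by
      intro x hx
      rw [hY₁cells, Finset.mem_erase]
      exact ⟨fun h => hcY' (h ▸ hx), hsub hx⟩
    have hcard₁ : Y₁.cells.card = Y'.cells.card + d := by
      rw [hY₁cells, Finset.card_erase_of_mem hcY]
      omega
    have hYc : Y.cells.card = Y₁.cells.card + 1 := by omega
    calc Nat.card (StdFilling Y'.cells.card Y') ≤ Nat.card (StdFilling Y₁.cells.card Y₁) :=
          ih Y' Y₁ hsub₁ hcard₁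
      _ ≤ Nat.card (StdFilling Y.cells.card Y) := by
          rw [hYc]
          exact card_stdFilling_removeAbove_le Y _ hcY

/-- **`f^μ ≤ f^λ` for partitions `μ ⊢ m`, `λ ⊢ n` with `μ ⊆ λ`** (Young diagrams). [folklore] -/
theorem numStandardTableaux_mono {m n : ℕ} (μ : Nat.Partition m) (lam : Nat.Partition n)
    (h : μ.youngDiagram.cells ⊆ lam.youngDiagram.cells) :
    numStandardTableaux μ ≤ numStandardTableaux lam := by
  rw [numStandardTableaux_eq_card_stdFilling, numStandardTableaux_eq_card_stdFilling]
  have hm := μ.card_cells_youngDiagram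
  have hn := lam.card_cells_youngDiagram
  have hmn : m ≤ n := by
    rw [← hm, ← hn]
    exact Finset.card_le_card h
  have key := card_stdFilling_mono (n - m) μ.youngDiagram lam.youngDiagram h (by rw [hm, hn]; omega)
  rwa [hm, hn] at key

/-! ### Transposition -/

/-- **`f^{λᵗ} = f^λ`** (`dim S^{λᵗ} = dim S^λ` through `S^{λᵗ} ≅ S^λ ⊗ sgn` and `dim S^μ = f^μ`).
[folklore] -/
theorem numStandardTableaux_transpose {n : ℕ} (lam : Nat.Partition n) :
    numStandardTableaux lam.transpose = numStandardTableaux lam := by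
  rw [← finrank_spechtIdeal_holds (k := ℂ) lam.transpose, ← finrank_spechtIdeal_holds (k := ℂ) lam]
  exact (spechtIdealTransposeEquiv ℂ lam).finrank_eq.symm

/-! ### Long first rows -/

/-- **`C(n, j) ≤ 3 f^{(a,ν)}` when `a ≥ 2j`** (`μ = (a, ν) ⊢ n`, `ν ⊢ j`): the tree's
`C(n,j) f^ν ≤ e f^μ` with `f^ν ≥ 1` and `e < 3`. [folklore] -/
theorem choose_le_three_mul_numStandardTableaux {n j a : ℕ} {μ : Nat.Partition n} {ν : Nat.Partition j}
    (hs : μ.sortedParts = a :: ν.sortedParts) (hja : 2 * j ≤ a) :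
    n.choose j ≤ 3 * numStandardTableaux μ := by
  have h := choose_mul_numStandardTableaux_le_exp_mul hs hja
  have hν : 1 ≤ numStandardTableaux ν := numStandardTableaux_pos_holds ν
  have he : Real.exp 1 ≤ 3 := le_trans Real.exp_one_lt_d9.le (by norm_num)
  have h2 : (n.choose j : ℝ) ≤ 3 * numStandardTableaux μ := by
    calc (n.choose j : ℝ) ≤ n.choose j * numStandardTableaux ν :=
          le_mul_of_one_le_right (by positivity) (by exact_mod_cast hν)
      _ ≤ Real.exp 1 * numStandardTableaux μ := h
      _ ≤ 3 * numStandardTableaux μ := mul_le_mul_of_nonneg_right he (by positivity)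
  exact_mod_cast h2

/-- `2^j ≤ C(n, j)` when `n ≥ 3j`. [folklore] -/
theorem two_pow_le_choose {n j : ℕ} (hn : 3 * j ≤ n) : 2 ^ j ≤ n.choose j := by
  have key : ∀ k, k ≤ j → 2 ^ k ≤ n.choose k := by
    intro k
    induction k with
    | zero => intro _; simp
    | succ k ih =>
      intro hk
      have h1 := ih (by omega)
      have h2 : n.choose (k + 1) * (k + 1) = n.choose k * (n - k) := Nat.choose_succ_right_eq n k
      have h3 : 2 * (k + 1) ≤ n - k := by omega
      have h4 : n.choose k * (2 * (k + 1)) ≤ n.choose (k + 1) * (k + 1) := by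
        rw [h2]; exact Nat.mul_le_mul_left _ h3
      have h5 : 2 * n.choose k ≤ n.choose (k + 1) := by
        have : 2 * n.choose k * (k + 1) ≤ n.choose (k + 1) * (k + 1) := by
          calc 2 * n.choose k * (k + 1) = n.choose k * (2 * (k + 1)) := by ring
            _ ≤ _ := h4
        exact Nat.le_of_mul_le_mul_right this (Nat.succ_pos k)
      calc 2 ^ (k + 1) = 2 * 2 ^ k := by ring
        _ ≤ 2 * n.choose k := Nat.mul_le_mul_left _ h1
        _ ≤ n.choose (k + 1) := h5
  exact key j le_rfl

/-! ### The index of a Young subgroup -/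

/-- Row `0` of the canonical tableau of `μ = (a, …)` consists of the entries `< a`. [folklore] -/
theorem rowOf_eq_zero_iff {n a : ℕ} (μ : Nat.Partition n) {l : List ℕ} (hs : μ.sortedParts = a :: l)
    (i : Fin n) : μ.rowOf i = 0 ↔ (i : ℕ) < a := by
  have h0 : 0 < μ.sortedParts.length := by rw [hs]; simp
  have h := μ.sum_take_succ_le_iff_lt_rowOf i h0
  rw [hs] at h
  simp only [zero_add, List.take_succ_cons, List.take_zero, List.sum_cons, List.sum_nil, add_zero] at h
  constructor
  · intro h0
    by_contra hlt
    rw [not_lt] at hlt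
    have := h.1 hlt
    omega
  · intro hlt
    by_contra h0
    have := h.2 (Nat.pos_of_ne_zero h0)
    omega

/-- **`[𝔖_n : R_μ] · a! ≤ n!`** for `μ = (a, …)`: the permutations of the first row form a subgroup
of order `a!` of the Young subgroup `R_μ`. [folklore] -/
theorem index_rowStabilizer_mul_factorial_le {n a : ℕ} (μ : Nat.Partition n) {l : List ℕ}
    (hs : μ.sortedParts = a :: l) :
    (rowStabilizer μ).index * a.factorial ≤ n.factorial := by
  classical
  have ha : a ≤ n := by
    have := μ.sum_sortedParts
    rw [hs, List.sum_cons] at this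
    omega
  -- the permutations of `{i : i < a}`
  set P : Subgroup (Equiv.Perm (Fin n)) :=
    (Equiv.Perm.ofSubtype : Equiv.Perm {i : Fin n // (i : ℕ) < a} →* Equiv.Perm (Fin n)).range
    with hP
  have hPle : P ≤ rowStabilizer μ := by
    rintro _ ⟨τ, rfl⟩
    rw [mem_rowStabilizer_iff]
    intro i
    by_cases hi : (i : ℕ) < a
    · have h1 : ((Equiv.Perm.ofSubtype τ) i : ℕ) < a := by
        rw [Equiv.Perm.ofSubtype_apply_of_mem τ hi]
        exact (τ ⟨i, hi⟩).2
      rw [(rowOf_eq_zero_iff μ hs _).2 h1, (rowOf_eq_zero_iff μ hs _).2 hi]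
    · rw [Equiv.Perm.ofSubtype_apply_of_not_mem τ hi]
  have hPcard : Nat.card P = a.factorial := by
    rw [hP, ← SetLike.coe_sort_coe, MonoidHom.coe_range,
      Nat.card_range_of_injective Equiv.Perm.ofSubtype_injective,
      Nat.card_perm, Nat.card_eq_fintype_card, Fintype.card_fin_lt_of_le ha]
  have hidx : (rowStabilizer μ).index ≤ P.index :=
    Nat.le_of_dvd (Nat.pos_of_ne_zero Subgroup.index_ne_zero_of_finite) (Subgroup.index_dvd_of_le hPle)
  have hPidx : P.index * a.factorial = n.factorial := by
    rw [← hPcard, Subgroup.index_mul_card, Nat.card_perm, Nat.card_eq_fintype_card, Fintype.card_fin]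
  calc (rowStabilizer μ).index * a.factorial ≤ P.index * a.factorial := Nat.mul_le_mul_right _ hidx
    _ = n.factorial := hPidx

end Summit.ValiantsHypothesis.ValiantsHypothesis.Theorems.SymPencilEquivariantSdcNotQP.YoungBounds

end
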